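import Summits.CriticalPhenomena.CardyFormulaZ2.Theorems.CardySelfRefinementLagHandOffColumnEscapeExterior
import Literature.Probability.LatticeModels.DobrushinDiscretisation
import HarnessLib

/-!
# Escape walks of faces crossing no edge of `Ω_δ`, III: every non-inner face escapes; the
outer face of `e_a` escapes; the column dictionary for Jordan / Dobrushin domains
(groundwork for stub `stub_tournamentTransfer`, line `hitting-tournament`, crux `LagHandOff`,
stmt-CriticalPhenomena-10268; registered sub-goal stub `stub_tournamentTransfer_escape`)

Last file of the series (`…ColumnEscapeCells`, `…ColumnEscapeExterior`).  For discrete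
Dobrushin data `E` whose domain is the carrier of a Jordan domain and whose mesh is positive
(escape relation of `Ω_δ` on faces:
`fun a b => (zdGraph 2).Adj a b ∧ sepEdge a b ∉ (discreteDomainGraph E.Ω E.δ).edgeSet`):

* `meshPoint_corner_mem_esc`, `reachable_of_escReach` — every corner of a face reached from `g`
  (finite reached set) is a mesh vertex, and all these corners are joined to `g` in the mesh
  graph on mesh vertices (adapted from `InnerFacesHoleFree.lean`; at a frontier corner no edge
  is an edge of `Ω_δ`, so all four cells around it are reached, one of them containing exterior
  points — excluded by part II);
* **`escape_of_not_isInnerFace`** — EVERY FACE THAT IS NOT INNER can be joined to faces of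
  arbitrary height by side-steps crossing no edge of `Ω_δ`: were the reached set of bounded
  height, it would be finite (part I); if `g ∈ Ω_δ` all corners of reached faces lie in `Ω_δ` (a
  union of mesh components) and all sides of `g` are edges of `Ω_δ`, i.e. `g` is inner; if
  `g ∉ Ω_δ` no such corner lies in `Ω_δ`, every side-step is allowed and `g` climbs straight up;
* **`exists_escape_outerFace`** — for ADMISSIBLE data with start corner `c₀` the outer face
  `faceAt c₀.1 (c₀.2 + 3)` of `e_a` (non-inner by `IsStartCorner.isOutEdge`) escapes by a walk of
  faces crossing no edge of `Ω_δ` to a face at least as high as `Ω_δ` — the escape hypothesis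
  of `medialExploration_first_column_iff`, at EVERY mesh at which the data are admissible;
  hence the exact column dictionary for Jordan domains
  (`medialExploration_first_column_iff_jordan`) and for the data of a `ZdDiscretisationFamily`
  of a Dobrushin domain (`exists_escape_outerFace_of_family`, `eventually_exists_escape_outerFace`);
* `stub_tournamentTransfer_escape` — the registered sub-goal, in tree vocabulary.

References: S. Smirnov, Ann. of Math. 172 (2010), §3 ("connected and simply connected"
lattice domains); S. Smirnov, C. R. Acad. Sci. Paris 333 (2001), §2 (`Ω_δ`, the largest
component); G. Grimmett, *Percolation* (1999), §11.2 (planar duality); N. Holden, X. Sun,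
arXiv:1905.13207, Prop. 6.25 (the dictionary this serves); the Jordan curve theorem of the tree
(`JordanCurveTheorem_holds`, `JordanDomain.exterior_of_JCT`).
-/

noncomputable section

open Set Metric Complex SimpleGraph
open Literature.Probability.Percolation Literature.Probability.LatticeModels
open Literature.Probability.LatticeModels.Mesh Literature.Probability.RandomPlanarGeometry

namespace Summit.CriticalPhenomena.CardyFormulaZ2.Cruxes.LagHandOff.HittingTournament

/-! ### Corners of trapped faces; the theorem -/

section Corners

variable {E : DiscreteDobrushin} (D : JordanDomain) (hΩ : E.Ω = D.carrier) (hδ : 0 < E.δ)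
  {g : Site 2}

include hΩ hδ

/-- **Every corner of a reached face is a mesh vertex** (its mesh point lies in `Ω`):
otherwise it is a frontier point, no edge at it is an edge of `Ω_δ`, so all four cells around
it are reached — including one containing exterior points (`exists_exterior_cell_near`),
contradicting `disjoint_cell_exterior_esc`. [folklore] -/
theorem meshPoint_corner_mem_esc (hRfin : {r | Relation.ReflTransGen (fun a b : Site 2 => (zdGraph 2).Adj a b ∧ sepEdge a b ∉ (discreteDomainGraph E.Ω E.δ).edgeSet) g r}.Finite)
    {r : Site 2} (hr : Relation.ReflTransGen (fun a b : Site 2 => (zdGraph 2).Adj a b ∧ sepEdge a b ∉ (discreteDomainGraph E.Ω E.δ).edgeSet) g r) {v : Site 2} (hv : IsCorner v r) :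
    meshPoint E.δ v ∈ E.Ω := by
  -- adapted from `Literature.Probability.LatticeModels.meshPoint_corner_mem`
  by_contra hvΩ
  have hΩo : IsOpen E.Ω := by rw [hΩ]; exact D.isOpen
  have hvcl : meshPoint E.δ v ∈ closure E.Ω :=
    closure_cell_subset_esc D hΩ hδ hRfin hr (meshPoint_mem_closure_cell_of_isCorner hδ hv)
  have hvfr : meshPoint E.δ v ∈ frontier E.Ω := mem_frontier_of_mem_closure hΩo hvcl hvΩ
  have hJE : frontier E.Ω ⊆ closure (closure E.Ω)ᶜ := by
    rw [hΩ]
    exact D.frontier_subset_closure_exterior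
      Literature.Topology.PlaneTopology.JordanCurveTheorem_holds
  obtain ⟨k', j', x, hk', hj', hxcell, hxV, -⟩ := exists_exterior_cell_near hδ (hJE hvfr)
  set f : Site 2 := ![k', j'] with hf
  have hfc : IsCorner v f := isCorner_of_coords (by simp [hf, hk']) (by simp [hf, hj'])
  obtain ⟨i₁, hi₁⟩ := exists_faceAt_of_isCorner hfc
  -- no edge at `v` is an edge of `Ω_δ` (else `v ∈ Ω_δ`, `δ v ∈ Ω`): all cells at `v` are reached
  have hvD : v ∉ meshDomain E.Ω E.δ := fun h => hvΩ (meshDomain_subset_meshVertices _ _ h)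
  obtain ⟨i₀, hi₀⟩ := exists_faceAt_of_isCorner hv
  have hstep : ∀ i : Fin 4, Relation.ReflTransGen (fun a b : Site 2 => (zdGraph 2).Adj a b ∧ sepEdge a b ∉ (discreteDomainGraph E.Ω E.δ).edgeSet) g (faceAt v i) →
      Relation.ReflTransGen (fun a b : Site 2 => (zdGraph 2).Adj a b ∧ sepEdge a b ∉ (discreteDomainGraph E.Ω E.δ).edgeSet) g (faceAt v (i + 1)) := fun i hi =>
    hi.tail ⟨adj_faceAt_succ v i, fun hmem => hvD (by
      rw [sepEdge_faceAt_succ] at hmem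
      exact (discreteDomainGraph_adj_iff.1 ((mem_edgeSet _).1 hmem)).2.1)⟩
  have h0 : Relation.ReflTransGen (fun a b : Site 2 => (zdGraph 2).Adj a b ∧ sepEdge a b ∉ (discreteDomainGraph E.Ω E.δ).edgeSet) g (faceAt v i₀) := hi₀ ▸ hr
  have h1 := hstep _ h0
  have h2 := hstep _ h1
  have h3 := hstep _ h2
  have hfR : Relation.ReflTransGen (fun a b : Site 2 => (zdGraph 2).Adj a b ∧ sepEdge a b ∉ (discreteDomainGraph E.Ω E.δ).edgeSet) g f := by
    rw [hi₁]
    have : i₁ = i₀ ∨ i₁ = i₀ + 1 ∨ i₁ = i₀ + 1 + 1 ∨ i₁ = i₀ + 1 + 1 + 1 := by omega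
    rcases this with rfl | rfl | rfl | rfl
    · exact h0
    · exact h1
    · exact h2
    · exact h3
  have hdis := disjoint_cell_exterior_esc D hΩ hδ hRfin hfR
  have hx' : x ∈ cell E.δ (f 0) (f 1) := by simpa [hf] using hxcell
  rw [hΩ] at hxV
  exact Set.disjoint_left.1 hdis hx' hxV

/-- The sides of a reached face are mesh edges. [folklore] -/
theorem meshGraph_adj_of_corners_esc (hRfin : {r | Relation.ReflTransGen (fun a b : Site 2 => (zdGraph 2).Adj a b ∧ sepEdge a b ∉ (discreteDomainGraph E.Ω E.δ).edgeSet) g r}.Finite)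
    {r : Site 2} (hr : Relation.ReflTransGen (fun a b : Site 2 => (zdGraph 2).Adj a b ∧ sepEdge a b ∉ (discreteDomainGraph E.Ω E.δ).edgeSet) g r) {v w : Site 2} (hv : IsCorner v r)
    (hw : IsCorner w r) (hadj : (zdGraph 2).Adj v w) : (meshGraph E.Ω E.δ).Adj v w :=
  meshGraph_adj_iff.2 ⟨hadj, (segment_subset_closure_cell_of_isCorner hδ hv hw).trans
    (closure_cell_subset_esc D hΩ hδ hRfin hr)⟩

/-- All corners of a reached face are joined, in the mesh graph on mesh vertices, to its
lower-left corner. [folklore] -/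
theorem reachable_corners_esc (hRfin : {r | Relation.ReflTransGen (fun a b : Site 2 => (zdGraph 2).Adj a b ∧ sepEdge a b ∉ (discreteDomainGraph E.Ω E.δ).edgeSet) g r}.Finite)
    {r : Site 2} (hr : Relation.ReflTransGen (fun a b : Site 2 => (zdGraph 2).Adj a b ∧ sepEdge a b ∉ (discreteDomainGraph E.Ω E.δ).edgeSet) g r) {v : Site 2} (hv : IsCorner v r) :
    ∃ (h₁ : r ∈ meshVertices E.Ω E.δ) (h₂ : v ∈ meshVertices E.Ω E.δ),
      (meshVertexGraph E.Ω E.δ).Reachable ⟨r, h₁⟩ ⟨v, h₂⟩ := by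
  -- adapted from `Literature.Probability.LatticeModels.reachable_corners`
  have hmem : ∀ u, IsCorner u r → u ∈ meshVertices E.Ω E.δ := fun u hu =>
    meshPoint_corner_mem_esc D hΩ hδ hRfin hr hu
  have hrc : IsCorner r r := isCorner_self r
  refine ⟨hmem r hrc, hmem v hv, ?_⟩
  obtain ⟨a, b, rfl⟩ := exists_corner_eq_of_isCorner hv
  have hcor : ∀ a b : Bool, IsCorner (Mesh.corner (r 0) (r 1) a b) r := fun a b =>
    isCorner_of_coords (by cases a <;> simp) (by cases b <;> simp)
  have hr0 : r = Mesh.corner (r 0) (r 1) false false := funext fun i => by fin_cases i <;> simp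
  have step1 : (meshVertexGraph E.Ω E.δ).Reachable ⟨r, hmem r hrc⟩
      ⟨Mesh.corner (r 0) (r 1) a false, hmem _ (hcor a false)⟩ := by
    cases a
    · have : (⟨r, hmem r hrc⟩ : meshVertices E.Ω E.δ) =
          ⟨Mesh.corner (r 0) (r 1) false false, hmem _ (hcor false false)⟩ := Subtype.ext hr0
      rw [this]
    · refine SimpleGraph.Adj.reachable ((meshVertexGraph_adj_iff _ _).2 ?_)
      have := meshGraph_adj_of_corners_esc D hΩ hδ hRfin hr (hcor false false) (hcor true false)
        (zdGraph_adj_corner_horizontal _ _ false)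
      rwa [← hr0] at this
  refine step1.trans ?_
  cases b
  · exact Reachable.refl _
  · exact SimpleGraph.Adj.reachable ((meshVertexGraph_adj_iff _ _).2
      (meshGraph_adj_of_corners_esc D hΩ hδ hRfin hr (hcor a false) (hcor a true)
        (zdGraph_adj_corner_vertical _ _ a)))

/-- All corners of all reached faces are joined to the lower-left corner of `g`. [folklore] -/
theorem reachable_of_escReach (hRfin : {r | Relation.ReflTransGen (fun a b : Site 2 => (zdGraph 2).Adj a b ∧ sepEdge a b ∉ (discreteDomainGraph E.Ω E.δ).edgeSet) g r}.Finite)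
    {r : Site 2} (hr : Relation.ReflTransGen (fun a b : Site 2 => (zdGraph 2).Adj a b ∧ sepEdge a b ∉ (discreteDomainGraph E.Ω E.δ).edgeSet) g r) :
    ∀ {v : Site 2}, IsCorner v r → ∃ (h₁ : g ∈ meshVertices E.Ω E.δ) (h₂ : v ∈ meshVertices E.Ω E.δ),
      (meshVertexGraph E.Ω E.δ).Reachable ⟨g, h₁⟩ ⟨v, h₂⟩ := by
  -- adapted from `Literature.Probability.LatticeModels.reachable_of_reach`
  induction hr with
  | refl => intro v hv; exact reachable_corners_esc D hΩ hδ hRfin Relation.ReflTransGen.refl hv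
  | tail hr hst ih =>
    rename_i a b
    intro v hv
    obtain ⟨k, rfl⟩ := exists_eq_add_cornerUnit hst.1
    have hca : IsCorner (a + cornerOff (k + 1)) a := by
      have := isCorner_faceAt (a + cornerOff (k + 1)) (k + 1); rwa [faceAt_add_cornerOff] at this
    have hcb : IsCorner (a + cornerOff (k + 1)) (a + cornerUnit k) := by
      have := isCorner_faceAt (a + cornerUnit k + cornerOff k) k
      rw [faceAt_add_cornerOff] at this
      rwa [add_assoc, show cornerUnit k + cornerOff k = cornerOff (k + 1) by
        rw [cornerUnit_eq_off_sub]; abel] at this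
    obtain ⟨h₁, h₂, hreach⟩ := ih hca
    have hbr := hr.tail hst
    obtain ⟨h₃, h₄, hreach'⟩ := reachable_corners_esc D hΩ hδ hRfin hbr hcb
    obtain ⟨h₆, h₅, hreach''⟩ := reachable_corners_esc D hΩ hδ hRfin hbr hv
    exact ⟨h₁, h₅, hreach.trans (hreach'.symm.trans hreach'')⟩

/-! ### The theorem: every non-inner face escapes without crossing `Ω_δ` -/

/-- **Every face that is not inner escapes without crossing an edge of `Ω_δ` (Jordan domains).**
For discrete Dobrushin data `E` whose domain is the carrier of a Jordan domain and whose mesh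
is positive, every face `g` that is NOT an inner face of `E` can be joined to faces of
arbitrary height by side-steps through adjacent faces none of which crosses an edge of
`Ω_δ = discreteDomainGraph E.Ω E.δ`.  (Equivalently: the open unit square of `g` lies in the
unbounded face of the planar embedding of `Ω_δ`.)  This sharpens `holeFree_innerFaces`
(hole-freeness of the inner faces, Smirnov 2010 §3 "simply connected lattice domains"), whose
steps may cross edges of `Ω_δ` bordered by two non-inner faces.  Proof: if the reached faces
had bounded height they would form a finite set whose closed cells lie in `closure Ω`
(`disjoint_cell_exterior_esc`) with all corners mesh vertices joined to `g` in the mesh graph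
(`reachable_of_escReach`); if `g ∈ Ω_δ` then all these corners lie in `Ω_δ` (a union of mesh
components) and all sides of `g` are edges of `Ω_δ`, i.e. `g` is inner; if `g ∉ Ω_δ` then no
such corner lies in `Ω_δ`, every side-step is allowed, and `g` escapes straight up.
[cite: Smirnov2010, §3 (simply connected lattice domains)] -/
theorem escape_of_not_isInnerFace (g : Site 2) (hg : ¬ E.IsInnerFace g) (M : ℤ) :
    ∃ g', M ≤ g' 1 ∧ Relation.ReflTransGen (fun a b : Site 2 => (zdGraph 2).Adj a b ∧ sepEdge a b ∉ (discreteDomainGraph E.Ω E.δ).edgeSet) g g' := by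
  by_contra hcon
  push Not at hcon
  have hM : ∀ r, Relation.ReflTransGen (fun a b : Site 2 => (zdGraph 2).Adj a b ∧ sepEdge a b ∉ (discreteDomainGraph E.Ω E.δ).edgeSet) g r → r 1 < M :=
    fun r hr => not_le.1 fun h => hcon r h hr
  have hΩb : Bornology.IsBounded E.Ω := by rw [hΩ]; exact D.isBounded
  obtain ⟨X₁, X₂, Y₁, Y₂, hbox⟩ := exists_box_meshDomain hΩb hδ
  have hRfin := finite_escReach hbox hM
  by_cases hgD : g ∈ meshDomain E.Ω E.δ
  · -- every corner of `g` is in `Ω_δ` and every side of `g` is an edge of `Ω_δ`: `g` is inner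
    refine hg fun v w hv hw hadj => discreteDomainGraph_adj_iff.2 ⟨?_, ?_, ?_⟩
    · exact meshGraph_adj_of_corners_esc D hΩ hδ hRfin Relation.ReflTransGen.refl hv hw hadj
    · obtain ⟨h₁, h₂, hreach⟩ := reachable_of_escReach D hΩ hδ hRfin Relation.ReflTransGen.refl hv
      exact mem_meshDomain_of_reachable hgD hreach
    · obtain ⟨h₁, h₂, hreach⟩ := reachable_of_escReach D hΩ hδ hRfin Relation.ReflTransGen.refl hw
      exact mem_meshDomain_of_reachable hgD hreach
  · -- no corner of a reached face is in `Ω_δ`: climb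
    have key : ∀ n : ℕ, Relation.ReflTransGen (fun a b : Site 2 => (zdGraph 2).Adj a b ∧ sepEdge a b ∉ (discreteDomainGraph E.Ω E.δ).edgeSet) g (g + n • cornerUnit 1) := by
      intro n
      induction n with
      | zero => simpa using Relation.ReflTransGen.refl
      | succ n ih =>
        rw [add_succ_nsmul_cornerUnit]
        refine ih.tail (escAdj_up fun hmem => hgD ?_)
        have hc : IsCorner (g + n • cornerUnit 1 + cornerUnit 1) (g + n • cornerUnit 1) := by
          have := isCorner_faceAt (g + n • cornerUnit 1 + cornerOff 3) 3
          rwa [faceAt_add_cornerOff] at this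
        obtain ⟨h₁, h₂, hreach⟩ := reachable_of_escReach D hΩ hδ hRfin ih hc
        exact mem_meshDomain_of_reachable hmem hreach.symm
    obtain ⟨n, hn⟩ : ∃ n : ℕ, M ≤ g 1 + n := ⟨(M - g 1).toNat, by omega⟩
    have h := hM _ (key n)
    rw [add_nsmul_cornerUnit_apply] at h
    simp at h; omega

end Corners

/-! ### The escape of the outer face of `e_a`; the dictionary for Jordan / Dobrushin data -/

section Escape

variable {E : DiscreteDobrushin} {c₀ : Site 2 × Fin 4}

/-- **The outer face of `e_a` escapes.** For admissible discrete Dobrushin data `E` whose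
domain is the carrier of a Jordan domain, with start corner `c₀` (source edge `e_a`, inner
face `faceAt c₀.1 c₀.2`, outer = non-inner face `o = faceAt c₀.1 (c₀.2 + 3)`), there is a walk
of faces from `o`, crossing no edge of `Ω_δ`, to a face `uTop` at least as high as every site
of `Ω_δ` — the escape hypothesis of `medialExploration_first_column_iff`, for every mesh at
which the data are admissible (no smallness of the mesh is needed). [folklore] -/
theorem exists_escape_outerFace (D : JordanDomain) (hΩ : E.Ω = D.carrier) (hE : E.IsZdAdmissible)
    (hc₀ : E.IsStartCorner c₀) :
    ∃ (uTop : Site 2) (ε : (zdGraph 2).Walk (faceAt c₀.1 (c₀.2 + 3)) uTop),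
      (∀ d ∈ ε.darts, sepEdge d.fst d.snd ∉ (discreteDomainGraph E.Ω E.δ).edgeSet) ∧
      ∀ z ∈ meshDomain E.Ω E.δ, z 1 ≤ uTop 1 := by
  obtain ⟨X₁, X₂, Y₁, Y₂, hbox⟩ := exists_box_meshDomain hE.isBounded hE.delta_pos
  obtain ⟨g', hg', hchain⟩ :=
    escape_of_not_isInnerFace D hΩ hE.delta_pos _ hc₀.isOutEdge.2 Y₂
  obtain ⟨ε, hε⟩ := exists_walk_of_reflTransGen_esc hchain
  exact ⟨g', ε, hε, fun z hz => (hbox z hz).2.2.2.trans hg'⟩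

/-- **The lattice dictionary at a column cross-cut for Jordan domains** (the escape hypothesis
of `medialExploration_first_column_iff` discharged): for admissible data on a Jordan domain
with start corner strictly west of the column `{re = k}` and an exploration that does not stay
in `{re < k}`, the arrival vertex `v` of the exploration at the column is joined to the `A`-end
of `e_a` by open edges of `{re < k}`, and no column site strictly below `v` on the same column
segment of `Ω_δ` is. (Holden–Sun, arXiv:1905.13207, Prop. 6.25 (1), for the bond-`ℤ²` medial
exploration of Smirnov 2001 §2.) [cite: Smirnov2001, §2] -/
theorem medialExploration_first_column_iff_jordan (D : JordanDomain) (hΩ : E.Ω = D.carrier)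
    (hE : E.IsZdAdmissible) (hc₀ : E.IsStartCorner c₀) (ω : BondConfig (Site 2)) {k : ℤ}
    (hwest : c₀.1 0 < k) (heast : ∃ e ∈ medialExploration E ω, 2 * k ≤ edgeAbs2 e) :
    ∃ (τ : ℕ) (v : Site 2), τ + 2 < (medialExploration E ω).length ∧ v 0 = k ∧
      (medialExploration E ω)[τ + 2]? = some s(v, v + cornerUnit 3) ∧
      (∀ i < τ + 2, ∀ e, (medialExploration E ω)[i]? = some e → edgeAbs2 e < 2 * k) ∧
      E.bcBondConfig ω ∩ {e | edgeAbs2 e < 2 * k} ∈ openConnIn {u : Site 2 | u 0 ≤ k} c₀.1 v ∧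
      ∀ w : Site 2, w 0 = k → w 1 < v 1 →
        (∀ z : Site 2, z 0 = k → w 1 ≤ z 1 → z 1 < v 1 →
          (discreteDomainGraph E.Ω E.δ).Adj z (z + Pi.single 1 1)) →
        ∀ S : Set (Site 2), E.bcBondConfig ω ∩ {e | edgeAbs2 e < 2 * k} ∉ openConnIn S c₀.1 w := by
  obtain ⟨uTop, ε, hε, htop⟩ := exists_escape_outerFace D hΩ hE hc₀
  exact medialExploration_first_column_iff hE hc₀ ω hwest heast ε hε htop

/-- **Escape for discretisation families of a Dobrushin domain**: at every mesh `δ` at which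
the data `E δ` of a `ZdDiscretisationFamily D E` are admissible (in particular for all small
`δ > 0`, `eventually_isZdAdmissible`), the outer face of `e_a` escapes. [folklore] -/
theorem exists_escape_outerFace_of_family {D : DobrushinDomain} {E : ℝ → DiscreteDobrushin}
    (h : ZdDiscretisationFamily D E) {δ : ℝ} (hE : (E δ).IsZdAdmissible)
    {c₀ : Site 2 × Fin 4} (hc₀ : (E δ).IsStartCorner c₀) :
    ∃ (uTop : Site 2) (ε : (zdGraph 2).Walk (faceAt c₀.1 (c₀.2 + 3)) uTop),
      (∀ d ∈ ε.darts, sepEdge d.fst d.snd ∉ (discreteDomainGraph (E δ).Ω (E δ).δ).edgeSet) ∧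
      ∀ z ∈ meshDomain (E δ).Ω (E δ).δ, z 1 ≤ uTop 1 :=
  exists_escape_outerFace D.toJordanDomain (h.Ω_eq δ) hE hc₀

/-- The eventual form: for all small `δ > 0` and every start corner of `E δ`, the outer face of
`e_a` escapes. [folklore] -/
theorem eventually_exists_escape_outerFace {D : DobrushinDomain} {E : ℝ → DiscreteDobrushin}
    (h : ZdDiscretisationFamily D E) :
    ∀ᶠ δ in nhdsWithin (0 : ℝ) (Set.Ioi 0), ∀ c₀ : Site 2 × Fin 4, (E δ).IsStartCorner c₀ →
      ∃ (uTop : Site 2) (ε : (zdGraph 2).Walk (faceAt c₀.1 (c₀.2 + 3)) uTop),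
        (∀ d ∈ ε.darts, sepEdge d.fst d.snd ∉ (discreteDomainGraph (E δ).Ω (E δ).δ).edgeSet) ∧
        ∀ z ∈ meshDomain (E δ).Ω (E δ).δ, z 1 ≤ uTop 1 :=
  h.eventually_isZdAdmissible.mono fun _ hE _ hc₀ => exists_escape_outerFace_of_family h hE hc₀

/-- **Registered sub-goal stub `stub_tournamentTransfer_escape`** (tree vocabulary; =
`exists_escape_outerFace` for the carrier of a Dobrushin domain). [folklore] -/
theorem stub_tournamentTransfer_escape : ∀ (D : DobrushinDomain) (E : DiscreteDobrushin) (c₀ : Site 2 × Fin 4), E.Ω = D.carrier → E.IsZdAdmissible → E.IsStartCorner c₀ → ∃ (uTop : Site 2) (ε : (zdGraph 2).Walk (faceAt c₀.1 (c₀.2 + 3)) uTop), (∀ d ∈ ε.darts, sepEdge d.fst d.snd ∉ (discreteDomainGraph E.Ω E.δ).edgeSet) ∧ ∀ z ∈ meshDomain E.Ω E.δ, z 1 ≤ uTop 1 :=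
  fun D _ _ hΩ hE hc₀ => exists_escape_outerFace D.toJordanDomain hΩ hE hc₀

end Escape

end Summit.CriticalPhenomena.CardyFormulaZ2.Cruxes.LagHandOff.HittingTournament

end
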